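import Literature.Analysis.FluidPDE.StokesTorus
import Literature.Analysis.FluidPDE.LerayProjectorTorusProofs
import HarnessLib

/-!
# Completeness of the Stokes eigenfields on the flat torus (proofs)

`Literature.Analysis.FluidPDE.StokesTorus` vendors, as named facts, two forms of the completeness of
the real Stokes eigenfields `cos(2πk·x) a`, `sin(2πk·x) a` (`k ∈ ℤ^d ∖ {0}`, `a ⊥ k`) in the energy
space `H = Torus.energySpace d` (Constantin–Foias 1988, Ch. 4, (4.4)–(4.7): the eigenfunctions
`(w_j)` of the Stokes operator are an orthonormal basis of `H`; periodic case (4.33), (4.42):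
`H = {u | u₀ = 0, ⟨u_k, k⟩ = 0}`, eigenfunctions `c w_k + c̄ w_{-k}` with `⟨c, k⟩ = 0`; Ch. 7, (7.4):
`P_m f = ∑_{j ≤ m} (w_j, f) w_j`):

* `Torus.tendsto_galerkinProj` — `P_N v → v` in `L²` for `v ∈ H`;
* `Torus.topologicalClosure_iSup_galerkinSpace` — `closure (⋃_N galerkinSpace N) = H`.

This file **proves** both (`…_holds`). The inclusion `galerkinSpace N ≤ H` is the sibling
discharge `Torus.galerkinSpace_le_energySpace_holds` of `StokesTorusProofs` (re-derived here in
eight lines from the frame-field description, `galerkinSpace_le_energySpace_aux`, so that this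
file does not depend on that sibling's import closure); the content of this file is the converse
density `H ≤ closure (⨆_N galerkinSpace N)`, obtained on the Fourier side (the source argues
abstractly through the compactness of `A⁻¹`, (4.4)–(4.7); in the periodic case the same
completeness is Parseval plus the description (4.33) of `H`, both already in the Literature).

## Proof

Write `W = ⨆_N galerkinSpace N ≤ L²(T^d; ℝ^d)`; `W̄ = Wᗮᗮ` (Mathlib's
`Submodule.orthogonal_orthogonal_eq_closure`). Let `u ⊥ W` and `v ∈ H`.

* Each generator `stokesModeL2 k (projPerp k j) c` (`k ≠ 0`) is, as an `L²` class, the single real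
  mode `Re (e_k • frameVec k j c)` of `StatisticalSolutionEnergyEq` (`stokesModeL2_projPerp_eq_toLp`;
  `projPerp = perpVec` definitionally), whose `L²` pairing with `u` is `Re ⟪û(k), frameVec k j c⟫_ℂ`
  (`Torus.inner_toLp_realTrigPoly_singleton`). The two phases `c` give
  `⟪û(k), complexify (perpVec k j)⟫_ℂ = 0` for every `j`, so `û(k)` is `ℂ`-orthogonal to every
  transversal vector, these being the combinations `z = ∑ⱼ zⱼ • complexify (perpVec k j)`
  (`Torus.sum_smul_complexify_perpVec`).
* The coefficients of `v ∈ H` are transversal and `v̂(0) = 0` (CF 1988, (4.33):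
  `Torus.isWeaklyDivFree_of_mem_energySpace`, `Torus.IsWeaklyDivFree.sum_mul_mFourierCoeff_eq_zero`,
  `Torus.mFourierCoeff_complexify_coe_zero_of_mem`), so every term of Parseval's identity
  `⟪u, v⟫_{L²} = ∑_k Re ⟪û(k), v̂(k)⟫_ℂ` (`Torus.hasSum_re_inner_mFourierCoeff_complexify`;
  Grafakos 2014, Prop. 3.2.7 (3)) vanishes: `u ⊥ v`. Hence `H ≤ Wᗮᗮ = W̄`.
* Convergence: the orthogonal projections onto the increasing complete subspaces
  `galerkinSpace N` converge pointwise to the projection onto `W̄` (Mathlib's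
  `Submodule.starProjection_tendsto_closure_iSup`), which fixes `v ∈ H ≤ W̄`.

## References

* P. Constantin, C. Foias, *Navier–Stokes Equations*, Univ. Chicago Press (1988), Ch. 4,
  (4.4)–(4.7), (4.33), (4.42); Ch. 7, (7.4). [ConstantinFoias1988]
* L. Grafakos, *Classical Fourier Analysis*, 3rd ed., GTM 249 (2014), Prop. 3.2.7 (3). [Grafakos2014]
-/

noncomputable section

open MeasureTheory Filter UnitAddTorus
open scoped InnerProductSpace RealInnerProductSpace ENNReal Topology

namespace Literature.Analysis.FluidPDE

namespace Torus

variable {d : Type*} [Fintype d] [DecidableEq d]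

/-! ## The Galerkin modes are the frame fields -/

/-- The Galerkin mode `stokesMode k (projPerp k j) c` *is* the frame field
`Re (e_k • frameVec k j c)` of `StatisticalSolutionEnergyEq` (`projPerp = perpVec` definitionally;
`Re (e_k p) = cos(2πk·x) p`, `Re (e_k (-i p)) = sin(2πk·x) p` for real `p`). [folklore] -/
theorem stokesMode_projPerp_apply (k : d → ℤ) (j : d) (c : Bool) (x : UnitAddTorus d) :
    stokesMode k (projPerp k j) c x =
      FunctionSpaces.Torus.realTrigPoly {k} (fun _ => frameVec k j c) x := by
  rw [FunctionSpaces.Torus.realTrigPoly_singleton_apply, stokesMode_apply]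
  have hp : ∀ i, projPerp k j i = perpVec k j i := fun _ => rfl
  ext i
  cases c
  · simp [frameVec, hp, Complex.mul_re]
  · simp [frameVec, hp, Complex.mul_re]

/-- The `L²` class of a Galerkin mode is the `L²` class of the corresponding frame field
`Re (e_k • frameVec k j c)`. [folklore] -/
theorem stokesModeL2_projPerp_eq_toLp (k : d → ℤ) (j : d) (c : Bool) :
    stokesModeL2 k (projPerp k j) c =
      (FunctionSpaces.Torus.memLp_realTrigPoly {k} (fun _ => frameVec k j c) 2).toLp
        (FunctionSpaces.Torus.realTrigPoly {k} fun _ => frameVec k j c) := by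
  refine Lp.ext ?_
  filter_upwards [coeFn_stokesModeL2 k (projPerp k j) c,
    MemLp.coeFn_toLp (FunctionSpaces.Torus.memLp_realTrigPoly {k} (fun _ => frameVec k j c) 2)]
    with x hx hy
  rw [hx, hy]
  exact stokesMode_projPerp_apply k j c x

/-- Every non-zero frequency belongs to some Galerkin frequency set (`|k|² ≤ N ≤ N²` for
`N = ⌈|k|²⌉`). [folklore] -/
private theorem exists_mem_galerkinIndex {k : d → ℤ} (hk : k ≠ 0) :
    ∃ N : ℕ, k ∈ galerkinIndex N := by
  refine ⟨⌈FunctionSpaces.Torus.freqNormSq k⌉₊, mem_galerkinIndex_iff'.2 ⟨?_, hk⟩⟩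
  calc FunctionSpaces.Torus.freqNormSq k ≤ (⌈FunctionSpaces.Torus.freqNormSq k⌉₊ : ℝ) :=
      Nat.le_ceil _
    _ ≤ (⌈FunctionSpaces.Torus.freqNormSq k⌉₊ : ℝ) ^ 2 := by
      exact_mod_cast Nat.le_self_pow two_ne_zero _

/-- The Galerkin modes lie in `⨆_N galerkinSpace N`. [folklore] -/
private theorem stokesModeL2_projPerp_mem_iSup {k : d → ℤ} (hk : k ≠ 0) (j : d) (c : Bool) :
    stokesModeL2 k (projPerp k j) c ∈ ⨆ N, galerkinSpace (d := d) N := by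
  obtain ⟨N, hN⟩ := exists_mem_galerkinIndex hk
  exact le_iSup (galerkinSpace (d := d)) N (Submodule.subset_span ⟨⟨⟨k, hN⟩, j, c⟩, rfl⟩)

/-- `galerkinSpace N ≤ H`: each generator is the `L²` class of a transversal single real mode
(`stokesModeL2_projPerp_eq_toLp`, `Torus.sum_mul_frameVec`), which lies in `𝒱 ⊆ H`
(`Torus.toLp_realTrigPoly_singleton_mem_energySpace`). This is the named fact
`Torus.galerkinSpace_le_energySpace`, publicly discharged as `Torus.galerkinSpace_le_energySpace_holds`
in the sibling `StokesTorusProofs` (by a direct smoothness/divergence computation); the short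
frame-field proof is kept private here only to avoid importing that sibling
(Constantin–Foias 1988, Ch. 4, (4.33) and (4.42)). [cite: ConstantinFoias1988, Ch. 4 (4.33) and (4.42)] -/
private theorem galerkinSpace_le_energySpace_aux (N : ℕ) :
    galerkinSpace (d := d) N ≤ FunctionSpaces.Torus.energySpace d := by
  refine Submodule.span_le.2 ?_
  rintro _ ⟨⟨⟨k, hk⟩, j, c⟩, rfl⟩
  have hk0 : k ≠ 0 := (mem_galerkinIndex_iff'.1 hk).2
  show stokesModeL2 k (projPerp k j) c ∈ FunctionSpaces.Torus.energySpace d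
  rw [stokesModeL2_projPerp_eq_toLp]
  exact toLp_realTrigPoly_singleton_mem_energySpace hk0 (sum_mul_frameVec hk0 j c)

/-! ## `H ≤ closure (⨆_N galerkinSpace N)` -/

/-- A field orthogonal to all Galerkin spaces pairs trivially with both phases of every mode:
`Re ⟪û(k), frameVec k j c⟫_ℂ = ⟪u, stokesModeL2 k (projPerp k j) c⟫_{L²} = 0` (`k ≠ 0`). [folklore] -/
private theorem re_inner_mFourierCoeff_frameVec_eq_zero
    {u : Lp (EuclideanSpace ℝ d) 2 (volume : Measure (UnitAddTorus d))}
    (hu : u ∈ (⨆ N, galerkinSpace (d := d) N)ᗮ) {k : d → ℤ} (hk : k ≠ 0) (j : d) (c : Bool) :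
    (inner ℂ (mFourierCoeff (FunctionSpaces.EuclideanSpace.complexify ∘
      (u : UnitAddTorus d → EuclideanSpace ℝ d)) k) (frameVec k j c)).re = 0 := by
  have h0 : ⟪u, stokesModeL2 k (projPerp k j) c⟫_ℝ = 0 :=
    Submodule.inner_left_of_mem_orthogonal (stokesModeL2_projPerp_mem_iSup hk j c) hu
  rwa [stokesModeL2_projPerp_eq_toLp, inner_toLp_realTrigPoly_singleton] at h0

/-- **Coefficients of a field orthogonal to all Galerkin spaces are longitudinal**: if
`u ⊥ ⨆_N galerkinSpace N`, `k ≠ 0` and `z ∈ ℂ^d` is transversal (`k · z = 0`), then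
`⟪û(k), z⟫_ℂ = 0`. The two phases give `⟪û(k), complexify (perpVec k j)⟫_ℂ = 0` for every `j`,
and `z = ∑ⱼ zⱼ • complexify (perpVec k j)` (`Torus.sum_smul_complexify_perpVec`)
(cf. Constantin–Foias 1988, Ch. 4, (4.39): the transversal projection `P_k` at frequency `k`). [folklore] -/
theorem inner_mFourierCoeff_eq_zero_of_mem_orthogonal_iSup
    {u : Lp (EuclideanSpace ℝ d) 2 (volume : Measure (UnitAddTorus d))}
    (hu : u ∈ (⨆ N, galerkinSpace (d := d) N)ᗮ) {k : d → ℤ} (hk : k ≠ 0)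
    {z : EuclideanSpace ℂ d} (hz : ∑ i, (k i : ℂ) * z i = 0) :
    inner ℂ (mFourierCoeff (FunctionSpaces.EuclideanSpace.complexify ∘
      (u : UnitAddTorus d → EuclideanSpace ℝ d)) k) z = 0 := by
  set w := mFourierCoeff (FunctionSpaces.EuclideanSpace.complexify ∘
    (u : UnitAddTorus d → EuclideanSpace ℝ d)) k with hw
  have hj : ∀ j, inner ℂ w (FunctionSpaces.EuclideanSpace.complexify (perpVec k j)) = 0 := by
    intro j
    have h1 := re_inner_mFourierCoeff_frameVec_eq_zero hu hk j true
    have h2 := re_inner_mFourierCoeff_frameVec_eq_zero hu hk j false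
    simp only [frameVec, ← hw] at h1 h2
    rw [inner_smul_right] at h2
    apply Complex.ext
    · simpa using h1
    · simpa [Complex.mul_re] using h2
  rw [← sum_smul_complexify_perpVec hz, inner_sum]
  simp [inner_smul_right, hj]

/-- A field orthogonal to all Galerkin spaces is orthogonal to `H`: for `u ⊥ ⨆_N galerkinSpace N`
and `v ∈ H`, `⟪u, v⟫_{L²} = ∑_k Re ⟪û(k), v̂(k)⟫_ℂ = 0` termwise — `v̂(0) = 0` and `v̂(k)` is
transversal (Constantin–Foias 1988, (4.33)) while `û(k)` kills transversal vectors
(`inner_mFourierCoeff_eq_zero_of_mem_orthogonal_iSup`); the series is Parseval's identity for real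
vector fields on `T^d` (Grafakos 2014, Prop. 3.2.7 (3)). [cite: Grafakos2014, Prop. 3.2.7 (3)] -/
theorem inner_eq_zero_of_mem_orthogonal_iSup_galerkinSpace
    {u v : Lp (EuclideanSpace ℝ d) 2 (volume : Measure (UnitAddTorus d))}
    (hu : u ∈ (⨆ N, galerkinSpace (d := d) N)ᗮ) (hv : v ∈ FunctionSpaces.Torus.energySpace d) :
    ⟪u, v⟫_ℝ = 0 := by
  have hP := FunctionSpaces.Torus.hasSum_re_inner_mFourierCoeff_complexify
    (Lp.memLp u) (Lp.memLp v)
  have hzero : (fun k : d → ℤ => (inner ℂ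
      (mFourierCoeff (FunctionSpaces.EuclideanSpace.complexify ∘
        (u : UnitAddTorus d → EuclideanSpace ℝ d)) k)
      (mFourierCoeff (FunctionSpaces.EuclideanSpace.complexify ∘
        (v : UnitAddTorus d → EuclideanSpace ℝ d)) k)).re) = fun _ => 0 := by
    funext k
    by_cases hk : k = 0
    · subst hk
      rw [mFourierCoeff_complexify_coe_zero_of_mem hv, inner_zero_right, Complex.zero_re]
    · rw [inner_mFourierCoeff_eq_zero_of_mem_orthogonal_iSup hu hk
        ((isWeaklyDivFree_of_mem_energySpace hv).sum_mul_mFourierCoeff_eq_zero (Lp.memLp v) k),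
        Complex.zero_re]
  rw [hzero] at hP
  rw [MeasureTheory.L2.inner_def]
  exact hP.unique hasSum_zero

/-- **`H` is contained in the closure of the Galerkin spaces**: `H ≤ closure (⨆_N galerkinSpace N)`
(`= (⨆_N galerkinSpace N)ᗮᗮ`, Mathlib's `Submodule.orthogonal_orthogonal_eq_closure`), by
`inner_eq_zero_of_mem_orthogonal_iSup_galerkinSpace` (Constantin–Foias 1988, Ch. 4, (4.7) with
(4.33), (4.42): the Stokes eigenfields are complete in `H`). [cite: ConstantinFoias1988, Ch. 4 (4.7)] -/
theorem energySpace_le_topologicalClosure_iSup_galerkinSpace :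
    FunctionSpaces.Torus.energySpace d ≤ (⨆ N, galerkinSpace (d := d) N).topologicalClosure := by
  intro v hv
  rw [← Submodule.orthogonal_orthogonal_eq_closure, Submodule.mem_orthogonal]
  intro u hu
  exact inner_eq_zero_of_mem_orthogonal_iSup_galerkinSpace hu hv

/-! ## The theorems -/

/-- **Convergence of the Galerkin projections** (discharge of the named fact
`Torus.tendsto_galerkinProj`): `P_N v → v` in `L²(T^d; ℝ^d)` as `N → ∞` for every `v ∈ H`
(Constantin–Foias 1988, Ch. 4, (4.4)–(4.7): the Stokes eigenfunctions `(w_j)` form an orthonormal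
basis of `H`; periodic case (4.33), (4.42); Ch. 7, (7.4): `P_m f = ∑_{j ≤ m} (w_j, f) w_j`). Proof:
the orthogonal projections onto the increasing complete subspaces `galerkinSpace N`
(`galerkinSpace_mono`) converge pointwise to the projection onto the closure of their union
(Mathlib's `Submodule.starProjection_tendsto_closure_iSup`), which contains `H`
(`energySpace_le_topologicalClosure_iSup_galerkinSpace`) and hence fixes `v`.
[cite: ConstantinFoias1988, Ch. 4 (4.7) and Ch. 7 (7.4)] -/
theorem tendsto_galerkinProj_holds : tendsto_galerkinProj (d := d) := by
  intro v hv
  have hmem : v ∈ (⨆ N, galerkinSpace (d := d) N).topologicalClosure :=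
    energySpace_le_topologicalClosure_iSup_galerkinSpace hv
  have h := Submodule.starProjection_tendsto_closure_iSup (galerkinSpace (d := d))
    galerkinSpace_mono v
  rw [Submodule.starProjection_eq_self_iff.mpr hmem] at h
  exact h

/-- **The Galerkin spaces exhaust `H`** (discharge of the named fact
`Torus.topologicalClosure_iSup_galerkinSpace`): the `L²` closure of `⋃_N galerkinSpace N` is `H`
(Constantin–Foias 1988, Ch. 4, (4.7) with (4.33), (4.42)). `≤`: `galerkinSpace N ≤ H`
(`galerkinSpace_le_energySpace_aux`, i.e. the fact `Torus.galerkinSpace_le_energySpace`) and `H` is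
closed (`Torus.isClosed_energySpace`); `≥`: `energySpace_le_topologicalClosure_iSup_galerkinSpace`.
[cite: ConstantinFoias1988, Ch. 4 (4.7)] -/
theorem topologicalClosure_iSup_galerkinSpace_holds :
    topologicalClosure_iSup_galerkinSpace (d := d) :=
  le_antisymm
    (Submodule.topologicalClosure_minimal _ (iSup_le galerkinSpace_le_energySpace_aux)
      FunctionSpaces.Torus.isClosed_energySpace)
    energySpace_le_topologicalClosure_iSup_galerkinSpace

end Torus

end Literature.Analysis.FluidPDE
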